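import Literature.AnabelianGeometry.EtaleTheta.ThetaCoversModelPiC
import Literature.AnabelianGeometry.EtaleTheta.Discharge.Sec2PiXIntoPiC
import Literature.AnabelianGeometry.EtaleTheta.Discharge.Sec2PiCAugmentation
import HarnessLib

/-!
# [EtTh] §2 over §1: the profinite `Π_C ⊇ Π_X ↠ G_K` of the §1 model — an inhabitant of
# `ThetaSetting.PiCData` from the C-level data (W3-L2-02 phase 2; closes GAP-LEDGER G-L2t10-2)

Mochizuki, *The étale theta function and its Frobenioid-theoretic manifestations*, Publ. RIMS **45**
(2009), §2 p. 36 (printed 262): "`Π_X ⊆ Π_C` … `1 → Δ_X → Π_X → G_K → 1`, `Δ_C := Ker(Π_C ↠ G_K)`,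
`Gal(X/C) ≅ ℤ/2ℤ`" [cite: MochizukiEtTh2009, Def 2.1 p.36].

Cell abc-iut, layer L2, W3-L2-02 (seat abc-iut-L2-d3; target named by abc-iut-L2-t10 g4 04:30:13Z). The
datum `ThetaSetting.PiCData D PiC` of `ThetaCoversModelPiC.lean` (seat abc-iut-L2-t10: `incl : Π_X ↪ Π_C`
injective with normal range of index `2`, `aug : Π_C → G_{ℚ_p}` extending `augHat` with range `G_K`) is
what `PiCData.coverDataAx` (the GENUINE `ThetaCovers.CoverDataAx` over the arithmetic setting) consumes.
This file CONSTRUCTS it from `e : M.CLevelData` (`MuTwoSettingCLevel.lean`: open embedding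
`Π^tp_X ↪ Π^tp_C`, augmentation `Π^tp_C ↠ G_K`):

* `CLevelData.piCDataOf e ιC hιC : M.PiCData P_C` for ANY profinite completion `ιC : Π^tp_C → P_C`
  (`incl :=` the transport `Φ` of `Sec2PiXIntoPiC` — injective, open-normal range of index `2`;
  `aug :=` the profinite augmentation of `Sec2PiCAugmentation` — `aug ∘ Φ = augHat`, range `G_K`);
* `CLevelData.PiCHat e`, `toPiCHat e`, `isProfiniteCompletion_toPiCHat`, `toPiCHat_injective` — THE
  profinite completion `Π^tp_C ↪ Π_C` chosen from `Sec2PiTpCResiduallyFinite` (P-C1 as a theorem);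
* `CLevelData.piCData e : M.PiCData (PiCHat e)` — the model's `Π_C ⊇ Π_X ↠ G_K`.

Definitions are `Classical.choose` of kernel-proved existence statements; no instance, no new named
`Prop` fact; nothing asserts that a `MuTwoSetting` exists; no side is taken on [IUTchIII] Cor. 3.12;
typed ≠ proved.
-/

noncomputable section

namespace Literature.AnabelianGeometry.EtaleTheta

open Literature.AnabelianGeometry.SemiGraphs
open _root_.Topology

namespace MuTwoSetting.CLevelData

variable {p : ℕ} [Fact p.Prime] {M : MuTwoSetting p}
variable {PC : Type} [Group PC] [TopologicalSpace PC] [IsTopologicalGroup PC] [T2Space PC]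

/-- **`Π_C ⊇ Π_X ↠ G_K` over any profinite completion `ιC : Π^tp_C → P_C`**: the `PiCData` of
abc-iut-L2-t10's `ThetaCoversModelPiC`, with `incl :=` the extension `Φ : Π_X → P_C` of `ιC ∘ inclX`
(injective, open normal range of index `2`) and `aug :=` the extension of `augC` (range `G_K`,
`aug ∘ Φ = augHat`). [cite: MochizukiEtTh2009, Def 2.1 p.36] -/
def piCDataOf (e : M.CLevelData) (ιC : M.GtpC →ₜ* PC) (hιC : IsProfiniteCompletion ιC) :
    M.toThetaSetting.PiCData PC :=
  let Φ : M.PiHat →ₜ* PC := Classical.choose (exists_hatInclX (M := M) ιC hιC)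
  have hΦ : ∀ x : M.PiTemp, Φ (M.toHat x) = ιC (M.inclX x) :=
    Classical.choose_spec (exists_hatInclX (M := M) ιC hιC)
  let A : PC →ₜ* GQp p := Classical.choose (e.exists_augHatC ιC hιC)
  have hA : ∀ g : M.GtpC, A (ιC g) = e.augC g := Classical.choose_spec (e.exists_augHatC ιC hιC)
  { incl := Φ
    incl_injective := e.injective_hatInclX ιC hιC Φ hΦ
    range_normal := by
      obtain ⟨V, -, hrange⟩ := exists_openNormal_range_hatInclX_eq (M := M) ιC hιC Φ hΦ
      have hV : Φ.toMonoidHom.range = V.toSubgroup := by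
        apply SetLike.coe_injective
        rw [MonoidHom.coe_range]
        exact hrange
      rw [hV]
      infer_instance
    index_range := index_range_hatInclX (M := M) ιC hιC Φ hΦ
    aug := A
    aug_incl := fun g => e.augHatC_hatInclX ιC A hA Φ hΦ g
    range_aug := e.range_augHatC ιC hιC A hA }

/-- The inclusion `incl` of `piCDataOf` extends `ιC ∘ inclX` along `toHat` (its defining property).
[cite: MochizukiEtTh2009, Def 2.1 p.36] -/
theorem piCDataOf_incl_toHat (e : M.CLevelData) (ιC : M.GtpC →ₜ* PC) (hιC : IsProfiniteCompletion ιC)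
    (x : M.PiTemp) : (e.piCDataOf ιC hιC).incl (M.toHat x) = ιC (M.inclX x) :=
  Classical.choose_spec (exists_hatInclX (M := M) ιC hιC) x

/-- The augmentation `aug` of `piCDataOf` extends `augC` along `ιC` (its defining property).
[cite: MochizukiEtTh2009, Def 2.1 p.36] -/
theorem piCDataOf_aug_apply (e : M.CLevelData) (ιC : M.GtpC →ₜ* PC) (hιC : IsProfiniteCompletion ιC)
    (g : M.GtpC) : (e.piCDataOf ιC hιC).aug (ιC g) = e.augC g :=
  Classical.choose_spec (e.exists_augHatC ιC hιC) g

/-- `aug ∘ ιC ∘ inclX = aug_X` for `piCDataOf`: the profinite augmentation restricted to `Π^tp_X` is the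
§1 augmentation `Π^tp_X → G_{ℚ_p}` (abc-iut-L2-t2's `OrbitEmbedding.aug_ι` shape).
[cite: MochizukiEtTh2009, Def 2.1 p.36] -/
theorem piCDataOf_aug_inclX (e : M.CLevelData) (ιC : M.GtpC →ₜ* PC) (hιC : IsProfiniteCompletion ιC)
    (x : M.PiTemp) : (e.piCDataOf ιC hιC).aug (ιC (M.inclX x)) = M.aug x := by
  rw [piCDataOf_aug_apply, e.augC_inclX]

/-! ### THE profinite completion `Π^tp_C ↪ Π_C` of the model (P-C1 as a theorem) -/

/-- **`Π_C`**: an injective profinite completion of `Π^tp_C`, chosen once and for all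
(`Sec2PiTpCResiduallyFinite.exists_isProfiniteCompletion_injective`). [cite: MochizukiEtTh2009, Prop 2.4 p.38] -/
def PiCHat (e : M.CLevelData) : ProfiniteGrp.{0} :=
  Classical.choose e.exists_isProfiniteCompletion_injective

/-- **`Π^tp_C → Π_C`**, the completion map. [cite: MochizukiEtTh2009, Prop 2.4 p.38] -/
def toPiCHat (e : M.CLevelData) : M.GtpC →ₜ* e.PiCHat :=
  Classical.choose (Classical.choose_spec e.exists_isProfiniteCompletion_injective)

/-- `Π^tp_C → Π_C` is a profinite completion in the sense of abc-iut-L3's `IsProfiniteCompletion`.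
[cite: MochizukiEtTh2009, Prop 2.4 p.38] -/
theorem isProfiniteCompletion_toPiCHat (e : M.CLevelData) : IsProfiniteCompletion e.toPiCHat :=
  (Classical.choose_spec (Classical.choose_spec e.exists_isProfiniteCompletion_injective)).1

/-- `Π^tp_C ↪ Π_C` is injective ([SemiAnbd] Prop. 3.6 "natural injection").
[cite: MochizukiEtTh2009, Prop 2.4 p.38] -/
theorem toPiCHat_injective (e : M.CLevelData) : Function.Injective e.toPiCHat :=
  (Classical.choose_spec (Classical.choose_spec e.exists_isProfiniteCompletion_injective)).2

/-- **The model's `Π_C ⊇ Π_X ↠ G_K`**: the `PiCData` over THE profinite completion of `Π^tp_C`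
(the input G-L2t10-2 of abc-iut-L2-t10's `PiCData.coverDataAx`, now constructed).
[cite: MochizukiEtTh2009, Def 2.1 p.36] -/
def piCData (e : M.CLevelData) : M.toThetaSetting.PiCData e.PiCHat :=
  e.piCDataOf e.toPiCHat e.isProfiniteCompletion_toPiCHat

/-- `incl ∘ toHat = toPiCHat ∘ inclX` for the model's `PiCData`. [cite: MochizukiEtTh2009, Def 2.1 p.36] -/
theorem piCData_incl_toHat (e : M.CLevelData) (x : M.PiTemp) :
    e.piCData.incl (M.toHat x) = e.toPiCHat (M.inclX x) :=
  e.piCDataOf_incl_toHat _ _ x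

/-- `aug ∘ toPiCHat = augC` for the model's `PiCData`. [cite: MochizukiEtTh2009, Def 2.1 p.36] -/
theorem piCData_aug_apply (e : M.CLevelData) (g : M.GtpC) : e.piCData.aug (e.toPiCHat g) = e.augC g :=
  e.piCDataOf_aug_apply _ _ g

/-- `aug ∘ toPiCHat ∘ inclX = aug_X` for the model's `PiCData`. [cite: MochizukiEtTh2009, Def 2.1 p.36] -/
theorem piCData_aug_inclX (e : M.CLevelData) (x : M.PiTemp) :
    e.piCData.aug (e.toPiCHat (M.inclX x)) = M.aug x :=
  e.piCDataOf_aug_inclX _ _ x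

end MuTwoSetting.CLevelData

end Literature.AnabelianGeometry.EtaleTheta

end
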